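import Mathlib
import HarnessLib

/-!
# Crux `PoloidalWindowRigidity` (K2, stmt-NavierStokesRegularity-19708) — the POLYNOMIAL and EXPONENTIAL-POLYNOMIAL sectors:
# the TYPED statements of THEOREM P and THEOREM E (memo `Cruxes/PoloidalWindowRigidity/POLY-SECTOR-K2p5.md` v4, seat ns-poloidal-K2-p5 g2)

This crux workfile TYPES — it does not kernel-prove — two statements proved on paper (with exact machine checks of the algebra,
`Cruxes/PoloidalWindowRigidity/POLY-SECTOR-K2p5-checks.md`) in the memo:

**THEOREM P (memo §6, §8).** `hempty` (the local (TH)∩twisting emptiness statement of K2-p3 p569136 = `stub_localTHEmpty` of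
`Lines/local_rigidity.lean` v1; binders VERBATIM below) HOLDS on the POLYNOMIAL SECTOR, i.e. when one adds the single hypothesis that on
every `(t, y₂)`-slice of `U` the velocity `u` is a polynomial in the horizontal variables `(y₀, y₁)`.

**THEOREM E (memo §11).** The same with «polynomial» replaced by «exponential polynomial in `(y₀, y₁)` with any finite complex spectrum
and polynomial amplitudes» (`IsHorizExpPolynomialOn`).  THEOREM E contains THEOREM P and supersedes, for this question, the mode lemma of
nsreg-p7 (STRUCTURE-g11 §7) and cstrat g3's N3.

Mechanism (memo): in the potential gauge `v = (∂ₓφ, ∂_yφ, m∂_zφ)`, `m = 1/μ`, the vertical momentum law has the universal quadratic form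
`Σ∇φ_j·∇U_k = rQ − ½∂_zQ + linear`, `r = −m′/(2m(m−1)) ≢ 0`; top-degree / top-frequency balances force the slope to a power law, classify the
top forms (planar / axisymmetric / isotropic-holomorphic), and a species calculus in `z` plus a chain of clean single-pair balances shows that no
mode of non-zero horizontal frequency carries vertical structure and that the polynomial sector is untwisted — contradicting the twist pin at `p₀`.

Both `theorem`s below are `sorry`: the proofs are the memo's and have NOT been ported to the kernel.  WHAT THIS IS NOT: not a kernel theorem,
not a proof of `hempty` (germs transcendental in the horizontal variables are untouched), not Navier–Stokes regularity — a typed paper result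
about the finite-horizontal-spectrum sector of local (TH) germs, filed so that refuters can attack the exact binders.
-/

noncomputable section

set_option linter.dupNamespace false

namespace Summit.NavierStokesRegularity.NavierStokesRegularity.Cruxes.PoloidalWindowRigidity.PolySector

open Set Function
open scoped RealInnerProductSpace InnerProductSpace Laplacian BigOperators

/-- `u` is, on every `(t, y₂)`-slice of `U`, a POLYNOMIAL in the horizontal variables `(y₀, y₁)` (componentwise; the polynomial may
depend on the slice). -/
def IsHorizPolynomialOn (U : Set (ℝ × EuclideanSpace ℝ (Fin 3)))
    (u : ℝ → EuclideanSpace ℝ (Fin 3) → EuclideanSpace ℝ (Fin 3)) : Prop :=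
  ∀ p ∈ U, ∀ i : Fin 3, ∃ P : MvPolynomial (Fin 2) ℝ, ∀ q ∈ U, q.1 = p.1 → q.2 2 = p.2 2 →
    u q.1 q.2 i = MvPolynomial.eval ![q.2 0, q.2 1] P

/-- `u` is, on every `(t, y₂)`-slice of `U`, an EXPONENTIAL POLYNOMIAL in the horizontal variables: a finite sum, over a fixed finite
set `S` of complex frequency pairs `(η₀, η₁)`, of complex polynomial amplitudes times `exp (η₀ y₀ + η₁ y₁)` (componentwise; amplitudes may
depend on the slice). -/
def IsHorizExpPolynomialOn (U : Set (ℝ × EuclideanSpace ℝ (Fin 3)))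
    (u : ℝ → EuclideanSpace ℝ (Fin 3) → EuclideanSpace ℝ (Fin 3)) : Prop :=
  ∃ S : Finset (ℂ × ℂ), ∀ p ∈ U, ∀ i : Fin 3, ∃ P : ℂ × ℂ → MvPolynomial (Fin 2) ℂ, ∀ q ∈ U, q.1 = p.1 → q.2 2 = p.2 2 →
    ((u q.1 q.2 i : ℝ) : ℂ) =
      ∑ σ ∈ S, MvPolynomial.eval ![((q.2 0 : ℝ) : ℂ), ((q.2 1 : ℝ) : ℂ)] (P σ) *
        Complex.exp (σ.1 * ((q.2 0 : ℝ) : ℂ) + σ.2 * ((q.2 1 : ℝ) : ℂ))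

/-- **THEOREM P (paper; memo POLY-SECTOR-K2p5.md §6 steady, §8 time-dependent): `hempty` restricted to the polynomial sector.**
VERBATIM the binders of `hempty` (K2-p3 `…LrcModEntireTwistingTHLocal.stub_twistingTH_of_localEmpty`; = `stub_localTHEmpty` of
`Lines/local_rigidity.lean`) plus `IsHorizPolynomialOn U u`.  Conclusion `False`: a polynomial-in-`(y₀,y₁)` (TH) germ with `∂_zμ ≠ 0`
is untwisted (memo THEOREM P), contradicting the twist pin at `p₀`. -/
def PolySector_NoTwistingTHGerm : Prop :=
  ∀ (u : ℝ → EuclideanSpace ℝ (Fin 3) → EuclideanSpace ℝ (Fin 3)) (μ A : ℝ → ℝ → ℝ)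
    (U : Set (ℝ × EuclideanSpace ℝ (Fin 3))) (p₀ : ℝ × EuclideanSpace ℝ (Fin 3)),
    IsOpen U → p₀ ∈ U →
    AnalyticOnNhd ℝ (Function.uncurry u) U →
    (∀ p ∈ U, AnalyticAt ℝ (Function.uncurry μ) (p.1, p.2 2)) →
    (∀ p ∈ U, AnalyticAt ℝ (Function.uncurry A) (p.1, p.2 2)) →
    (∀ p ∈ U, fderiv ℝ (u p.1) p.2 (EuclideanSpace.single 0 1) 1 = fderiv ℝ (u p.1) p.2 (EuclideanSpace.single 1 1) 0) →
    (∀ p ∈ U, fderiv ℝ (u p.1) p.2 (EuclideanSpace.single 0 1) 0 + fderiv ℝ (u p.1) p.2 (EuclideanSpace.single 1 1) 1 +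
      fderiv ℝ (u p.1) p.2 (EuclideanSpace.single 2 1) 2 = 0) →
    (∀ p ∈ U, ∀ b : Fin 3, b ≠ 2 →
      fderiv ℝ (u p.1) p.2 (EuclideanSpace.single 2 1) b =
        μ p.1 (p.2 2) * fderiv ℝ (u p.1) p.2 (EuclideanSpace.single b 1) 2) →
    (∀ p ∈ U,
      (1 - μ p.1 (p.2 2)) *
          (deriv (fun s => u s p.2 2) p.1 + fderiv ℝ (fun y => u p.1 y 2) p.2 (u p.1 p.2)
            - Δ (fun y => u p.1 y 2) p.2) =
        A p.1 (p.2 2) + (deriv (fun s => μ s (p.2 2)) p.1 - deriv (deriv (μ p.1)) (p.2 2)) * u p.1 p.2 2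
          + deriv (μ p.1) (p.2 2) / 2 * u p.1 p.2 2 ^ 2
          - 2 * deriv (μ p.1) (p.2 2) * fderiv ℝ (u p.1) p.2 (EuclideanSpace.single 2 1) 2) →
    -- the sector hypothesis
    IsHorizPolynomialOn U u →
    fderiv ℝ (fun y => fderiv ℝ (u p₀.1) y (EuclideanSpace.single 2 1) 2) p₀.2 (EuclideanSpace.single 0 1) *
          fderiv ℝ (u p₀.1) p₀.2 (EuclideanSpace.single 1 1) 2 -
        fderiv ℝ (fun y => fderiv ℝ (u p₀.1) y (EuclideanSpace.single 2 1) 2) p₀.2 (EuclideanSpace.single 1 1) *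
          fderiv ℝ (u p₀.1) p₀.2 (EuclideanSpace.single 0 1) 2 ≠ 0 →
    μ p₀.1 (p₀.2 2) ≠ 0 → μ p₀.1 (p₀.2 2) ≠ 1 → deriv (μ p₀.1) (p₀.2 2) ≠ 0 → False

/-- **THEOREM E (paper; memo §11, steady or time-dependent): `hempty` restricted to the EXPONENTIAL-POLYNOMIAL sector** — the same binders
with `IsHorizExpPolynomialOn U u` (any finite complex horizontal spectrum, polynomial amplitudes).  Conclusion `False`: such a germ carries
vertical structure only at horizontal frequency `0`, so it is either horizontally polynomial (THEOREM P) or has `∇_h u₂ ≡ 0`; both contradict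
the twist pin. -/
def ExpPolySector_NoTwistingTHGerm : Prop :=
  ∀ (u : ℝ → EuclideanSpace ℝ (Fin 3) → EuclideanSpace ℝ (Fin 3)) (μ A : ℝ → ℝ → ℝ)
    (U : Set (ℝ × EuclideanSpace ℝ (Fin 3))) (p₀ : ℝ × EuclideanSpace ℝ (Fin 3)),
    IsOpen U → p₀ ∈ U →
    AnalyticOnNhd ℝ (Function.uncurry u) U →
    (∀ p ∈ U, AnalyticAt ℝ (Function.uncurry μ) (p.1, p.2 2)) →
    (∀ p ∈ U, AnalyticAt ℝ (Function.uncurry A) (p.1, p.2 2)) →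
    (∀ p ∈ U, fderiv ℝ (u p.1) p.2 (EuclideanSpace.single 0 1) 1 = fderiv ℝ (u p.1) p.2 (EuclideanSpace.single 1 1) 0) →
    (∀ p ∈ U, fderiv ℝ (u p.1) p.2 (EuclideanSpace.single 0 1) 0 + fderiv ℝ (u p.1) p.2 (EuclideanSpace.single 1 1) 1 +
      fderiv ℝ (u p.1) p.2 (EuclideanSpace.single 2 1) 2 = 0) →
    (∀ p ∈ U, ∀ b : Fin 3, b ≠ 2 →
      fderiv ℝ (u p.1) p.2 (EuclideanSpace.single 2 1) b =
        μ p.1 (p.2 2) * fderiv ℝ (u p.1) p.2 (EuclideanSpace.single b 1) 2) →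
    (∀ p ∈ U,
      (1 - μ p.1 (p.2 2)) *
          (deriv (fun s => u s p.2 2) p.1 + fderiv ℝ (fun y => u p.1 y 2) p.2 (u p.1 p.2)
            - Δ (fun y => u p.1 y 2) p.2) =
        A p.1 (p.2 2) + (deriv (fun s => μ s (p.2 2)) p.1 - deriv (deriv (μ p.1)) (p.2 2)) * u p.1 p.2 2
          + deriv (μ p.1) (p.2 2) / 2 * u p.1 p.2 2 ^ 2
          - 2 * deriv (μ p.1) (p.2 2) * fderiv ℝ (u p.1) p.2 (EuclideanSpace.single 2 1) 2) →
    -- the sector hypothesis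
    IsHorizExpPolynomialOn U u →
    fderiv ℝ (fun y => fderiv ℝ (u p₀.1) y (EuclideanSpace.single 2 1) 2) p₀.2 (EuclideanSpace.single 0 1) *
          fderiv ℝ (u p₀.1) p₀.2 (EuclideanSpace.single 1 1) 2 -
        fderiv ℝ (fun y => fderiv ℝ (u p₀.1) y (EuclideanSpace.single 2 1) 2) p₀.2 (EuclideanSpace.single 1 1) *
          fderiv ℝ (u p₀.1) p₀.2 (EuclideanSpace.single 0 1) 2 ≠ 0 →
    μ p₀.1 (p₀.2 2) ≠ 0 → μ p₀.1 (p₀.2 2) ≠ 1 → deriv (μ p₀.1) (p₀.2 2) ≠ 0 → False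

/-- The polynomial sector is contained in the exponential-polynomial sector (spectrum `{0}`): THEOREM E implies THEOREM P.  Kernel-checked. -/
theorem polySector_of_expPolySector (h : ExpPolySector_NoTwistingTHGerm) : PolySector_NoTwistingTHGerm := by
  intro u μ A U p₀ hU hp₀ han hμ hA hpol hdiv hshear hE hsec htw hμ0 hμ1 hμz
  refine h u μ A U p₀ hU hp₀ han hμ hA hpol hdiv hshear hE ?_ htw hμ0 hμ1 hμz
  -- spectrum {0}, amplitude = the real polynomial mapped to ℂ
  refine ⟨{((0 : ℂ), (0 : ℂ))}, ?_⟩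
  intro p hp i
  obtain ⟨P, hP⟩ := hsec p hp i
  refine ⟨fun _ => MvPolynomial.map (algebraMap ℝ ℂ) P, ?_⟩
  intro q hq h1 h2
  rw [Finset.sum_singleton]
  simp only [zero_mul, zero_add, Complex.exp_zero, mul_one]
  rw [hP q hq h1 h2, MvPolynomial.eval_map]
  have hx : (fun j => ((![q.2 0, q.2 1] j : ℝ) : ℂ)) = ![((q.2 0 : ℝ) : ℂ), ((q.2 1 : ℝ) : ℂ)] := by
    funext j; fin_cases j <;> rfl
  rw [← hx]
  change Complex.ofRealHom (MvPolynomial.eval ![q.2 0, q.2 1] P) = _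
  rw [MvPolynomial.eval, MvPolynomial.coe_eval₂Hom, MvPolynomial.eval₂_comp_left]
  rfl

/-- THEOREM P — PAPER PROOF ONLY (memo POLY-SECTOR-K2p5.md §1–§6, §8; pure-python exact checks); not ported to the kernel. -/
theorem polySector_noTwistingTHGerm : PolySector_NoTwistingTHGerm := by
  sorry

/-- THEOREM E — PAPER PROOF ONLY (memo §9–§11); not ported to the kernel. -/
theorem expPolySector_noTwistingTHGerm : ExpPolySector_NoTwistingTHGerm := by
  sorry

end Summit.NavierStokesRegularity.NavierStokesRegularity.Cruxes.PoloidalWindowRigidity.PolySector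

end
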